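import Mathlib.MeasureTheory.MeasurableSpace.NCard
import Mathlib.MeasureTheory.Constructions.BorelSpace.Order
import Literature.Probability.Percolation.AnchoredIsoperimetricProfileProofs
import Literature.Probability.Percolation.PlanarDuality
import HarnessLib

/-!
# The anchored isoperimetric profile `φ̂_n` as a random variable; the limit statements

Topic `Literature/Probability/Percolation`. Second proofs file of
`AnchoredIsoperimetricProfile.lean` (Cerf–Dembin 2020, §1: the definitions `IsValidSubgraph`,
`openEdgeBoundaryCard`, `anchoredProfile` and the NAMED FACTS `CerfDembin2020_thm11` = Dembin 2020
Thm. 1, `CerfDembin2020_thm12`), on top of the elementary layer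
`AnchoredIsoperimetricProfileProofs.lean` (attained minimum, `0 ≤ φ̂_n ≤ 2d`, `φ̂_n = 0` for a
small cluster, `φ̂_n ≥ n^{-d}` on `{|C(0)| = ∞}`). Everything here is proved; no definition and no
named fact is introduced (D-0026).

## Contents

* §1 `φ̂_n = 0` **iff** `C(0)` is finite with `|C(0)| ≤ n^d` (`anchoredProfile_eq_zero_iff`,
  `anchoredProfile_eq_zero_iff_finite`; lattice configurations `ω ⊆ E(ℤ^d)`, true `P_p`-a.s.), the
  junk value `φ̂_n = 0` when `n^d = 0`, and the variants of the attained-minimum lemmas under the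
  sharp hypothesis `n^d ≥ 1`; hence on `{|C(0)| < ∞}`: `φ̂_n = 0` eventually and `n φ̂_n → 0`
  (`tendsto_mul_anchoredProfile_of_finite`) — the atom `(1 - θ(p)) δ_0` of the display
  "`lim n φ̂_n(p) = θ(p) δ_{φ(p)} + (1 - θ(p)) δ_0`" after [CerfDembin2020, Thm 1.1]; the atom
  `δ_{φ(p)}` on `{0 ∈ C_∞}` is the named fact `CerfDembin2020_thm11`, and
  `CerfDembin2020_thm11.ae_tendsto_mul_anchoredProfile` assembles the display from it.
* §2 **Measurability**: `{H valid}` is a cylinder event, `ω ↦ |∂_{C(0)} H|(ω)` is measurable, and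
  for `n^d ≥ 1`, `φ̂_n = inf_H F_H` over the countably many finite `H ⊆ ℤ^d`
  (`anchoredProfile_eq_iInf`), so `φ̂_n` is measurable (`measurable_anchoredProfile`) — the
  implicit standing fact that `φ_n`, `φ̂_n` are random variables in [Dembin2020, §1] ("we are
  interested in the ones that minimize …", probabilities of events `{n φ_n ≥ …}` in Thm. 3) and
  [CerfDembin2020, Thm 1.2].
* §3 **The dictionary with `CerfDembin2020_thm12`**: for `n^d ≥ 1`,
  `n φ̂_n ≤ c ↔ ∃ valid H, |H| ≤ n^d ∧ n |∂_{C(0)} H| ≤ c |H|` (`mul_anchoredProfile_le_iff`); the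
  vendored `ε`–`N` form of Theorem 1.2 is EQUIVALENT to "a.s., `∀ c > 0`, `n φ̂_n(p_c) ≤ c`
  infinitely often" (`CerfDembin2020_thm12_iff_frequently`) and IMPLIES the printed
  "`liminf n φ̂_n(p_c) = 0` a.s." for Mathlib's `Filter.liminf` (`CerfDembin2020_thm12.ae_liminf_eq_zero`;
  the converse fails only through the junk value of `sSup` on unbounded sets).

## What is NOT here

`CerfDembin2020_thm11_holds`: Dembin's proof (flow-constant norm `β_p` of Rossignol–Théret, upper
large deviations for maximal flows of Théret, Pisztora's supercritical coarse graining, Zhang's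
smooth cutsets, Wulff–Taylor isoperimetry for Caccioppoli sets) is not available in Mathlib or in
this tree.
-/

noncomputable section

namespace Literature.Probability.Percolation

open Finset LatticeModels
open _root_.MeasureTheory _root_.Filter
open scoped _root_.Topology

variable {d : ℕ}

/-! ## §1 `φ̂_n = 0` iff the cluster is small; the limit on `{|C(0)| < ∞}` -/

section ZeroIff

/-- The documented junk value: if `n^d = 0` (i.e. `n = 0` and `d ≥ 1`) no `H ∋ 0` has `|H| ≤ n^d`
and `φ̂_n = sInf ∅ = 0`. [cite: CerfDembin2020, §1 (definition of φ̂_n)] -/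
theorem anchoredProfile_of_pow_eq_zero {n : ℕ} (hn : n ^ d = 0) (ω : BondConfig (Site d)) :
    anchoredProfile d n ω = 0 := by
  unfold anchoredProfile
  convert Real.sInf_empty
  refine Set.eq_empty_iff_forall_notMem.2 ?_
  rintro r ⟨H, -, hpos, hle, -⟩
  omega

/-- In particular `φ̂_0 = 0` for `d ≥ 1`. [cite: CerfDembin2020, §1 (definition of φ̂_n)] -/
theorem anchoredProfile_zero_left (hd : d ≠ 0) (ω : BondConfig (Site d)) :
    anchoredProfile d 0 ω = 0 :=
  anchoredProfile_of_pow_eq_zero (by simp [hd]) ω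

/-- The set of competing ratios is non-empty as soon as `n^d ≥ 1` (the sharp condition;
`H = {0}` competes) — variant of `anchoredProfile_ratioSet_nonempty` (stated for `n ≥ 1`).
[cite: Dembin2020, §1 (definition of φ_n and of 𝒢_n)] -/
theorem anchoredProfile_ratioSet_nonempty' {n : ℕ} (hn : 1 ≤ n ^ d) (ω : BondConfig (Site d)) :
    {r : ℝ | ∃ H : Finset (Site d), IsValidSubgraph d ω H ∧ 0 < H.card ∧ H.card ≤ n ^ d ∧
      r = (openEdgeBoundaryCard d ω H : ℝ) / H.card}.Nonempty :=
  ⟨_, {0}, isValidSubgraph_singleton d ω, by simp, by simpa using hn, rfl⟩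

/-- The minimum is attained as soon as `n^d ≥ 1` — variant of
`exists_isValidSubgraph_anchoredProfile_eq`. [cite: Dembin2020, §1 (definition of φ_n and of 𝒢_n)] -/
theorem exists_isValidSubgraph_anchoredProfile_eq' {n : ℕ} (hn : 1 ≤ n ^ d)
    (ω : BondConfig (Site d)) :
    ∃ H : Finset (Site d), IsValidSubgraph d ω H ∧ 0 < H.card ∧ H.card ≤ n ^ d ∧
      anchoredProfile d n ω = (openEdgeBoundaryCard d ω H : ℝ) / H.card :=
  (anchoredProfile_ratioSet_nonempty' hn ω).csInf_mem (anchoredProfile_ratioSet_finite n ω)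

/-- `φ̂_n ≤ 2d` as soon as `n^d ≥ 1` — variant of `anchoredProfile_le_two_mul`.
[cite: CerfDembin2020, §1 (definition of φ̂_n)] -/
theorem anchoredProfile_le_two_mul' {n : ℕ} (hn : 1 ≤ n ^ d) (ω : BondConfig (Site d)) :
    anchoredProfile d n ω ≤ 2 * d := by
  refine (anchoredProfile_le_div (isValidSubgraph_singleton d ω) (by simpa using hn)).trans ?_
  have h := openEdgeBoundaryCard_le ω ({0} : Finset (Site d))
  rw [Finset.card_singleton, mul_one] at h
  rw [Finset.card_singleton, Nat.cast_one, div_one]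
  exact_mod_cast h

/-- A valid `H` with `|H| ≤ n^d` and no open boundary edge forces `φ̂_n = 0`.
[cite: CerfDembin2020, §1 (φ̂_n = 0 when C(0) is small)] -/
theorem anchoredProfile_eq_zero_of_openEdgeBoundaryCard_eq_zero {n : ℕ} {ω : BondConfig (Site d)}
    {H : Finset (Site d)} (hH : IsValidSubgraph d ω H) (hle : H.card ≤ n ^ d)
    (h0 : openEdgeBoundaryCard d ω H = 0) : anchoredProfile d n ω = 0 :=
  le_antisymm (by simpa [h0] using anchoredProfile_le_div hH hle) (anchoredProfile_nonneg n ω)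

/-- **`φ̂_n = 0` iff some valid `H` with `|H| ≤ n^d` has no open boundary edge** (`n^d ≥ 1`; the
minimum is attained and a ratio `k / |H|` vanishes iff `k = 0`).
[cite: CerfDembin2020, §1 (φ̂_n = 0 when C(0) is small)] -/
theorem anchoredProfile_eq_zero_iff {n : ℕ} (hn : 1 ≤ n ^ d) (ω : BondConfig (Site d)) :
    anchoredProfile d n ω = 0 ↔
      ∃ H : Finset (Site d), IsValidSubgraph d ω H ∧ H.card ≤ n ^ d ∧
        openEdgeBoundaryCard d ω H = 0 := by
  constructor
  · intro h
    obtain ⟨H, hH, -, hle, hr⟩ := exists_isValidSubgraph_anchoredProfile_eq' hn ω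
    rw [h, eq_comm, div_eq_zero_iff] at hr
    rcases hr with hr | hr
    · exact ⟨H, hH, hle, by exact_mod_cast hr⟩
    · have := hH.card_pos
      exact absurd hr (by positivity)
  · rintro ⟨H, hH, hle, h0⟩
    exact anchoredProfile_eq_zero_of_openEdgeBoundaryCard_eq_zero hH hle h0

/-- **`φ̂_n = 0` iff `C(0)` is finite with `|C(0)| ≤ n^d`** (`n^d ≥ 1`, lattice configurations
`ω ⊆ E(ℤ^d)`, which holds `P_p`-a.s.): the remark "taking `H = C(0)`, we see that `φ̂_n(p)` is
equal to `0`" of the source and its converse (a valid `H` without open boundary edge is all of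
`C(0)`, `IsValidSubgraph.coe_eq_openCluster_of_openEdgeBoundaryCard_eq_zero`).
[cite: CerfDembin2020, §1 (φ̂_n = 0 when C(0) is small)] -/
theorem anchoredProfile_eq_zero_iff_finite {n : ℕ} (hn : 1 ≤ n ^ d) {ω : BondConfig (Site d)}
    (hω : ω ⊆ (zdGraph d).edgeSet) :
    anchoredProfile d n ω = 0 ↔ (openCluster ω 0).Finite ∧ (openCluster ω 0).ncard ≤ n ^ d := by
  constructor
  · intro h
    obtain ⟨H, hH, hle, h0⟩ := (anchoredProfile_eq_zero_iff hn ω).1 h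
    rw [← hH.coe_eq_openCluster_of_openEdgeBoundaryCard_eq_zero hω h0]
    exact ⟨H.finite_toSet, by rwa [Set.ncard_coe_finset]⟩
  · rintro ⟨hfin, hle⟩
    exact anchoredProfile_eq_zero_of_finite hfin (by rwa [← Set.ncard_eq_toFinset_card _ hfin])

/-- On `{|C(0)| < ∞}`, `φ̂_n = 0` for all `n ≥ |C(0)|` (`d ≥ 1`, so that `|C(0)| ≤ n ≤ n^d`).
[cite: CerfDembin2020, §1 (φ̂_n = 0 when C(0) is small)] -/
theorem eventually_anchoredProfile_eq_zero (hd : 1 ≤ d) {ω : BondConfig (Site d)}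
    (hfin : (openCluster ω 0).Finite) : ∀ᶠ n : ℕ in atTop, anchoredProfile d n ω = 0 := by
  refine (eventually_ge_atTop (openCluster ω 0).ncard).mono fun n hn => ?_
  refine anchoredProfile_eq_zero_of_finite hfin ?_
  rw [← Set.ncard_eq_toFinset_card _ hfin]
  refine hn.trans ?_
  rcases Nat.eq_zero_or_pos n with rfl | hpos
  · simp
  · calc n = n ^ 1 := (pow_one n).symm
      _ ≤ n ^ d := Nat.pow_le_pow_right hpos hd

/-- **The atom at `0`**: on `{|C(0)| < ∞}`, `n φ̂_n → 0` (indeed `n φ̂_n = 0` eventually) — the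
`(1 - θ(p)) δ_0` part of "`lim n φ̂_n(p) = θ(p) δ_{φ(p)} + (1 - θ(p)) δ_0`"; the `δ_{φ(p)}` part on
`{0 ∈ C_∞}` is the named fact `CerfDembin2020_thm11` (Dembin 2020, Thm. 1), not proved here.
[cite: CerfDembin2020, §1 (display after Theorem 1.1)] -/
theorem tendsto_mul_anchoredProfile_of_finite (hd : 1 ≤ d) {ω : BondConfig (Site d)}
    (hfin : (openCluster ω 0).Finite) :
    Tendsto (fun n : ℕ => (n : ℝ) * anchoredProfile d n ω) atTop (𝓝 0) := by
  refine tendsto_const_nhds.congr' ?_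
  filter_upwards [eventually_anchoredProfile_eq_zero hd hfin] with n hn
  simp [hn]

open Classical in
/-- **Cerf–Dembin's display `lim n φ̂_n(p) = θ(p) δ_{φ(p)} + (1 - θ(p)) δ_0` for `p > p_c`**, as a
COROLLARY of the named fact `CerfDembin2020_thm11` (taken as a hypothesis) and of the proved atom at
`0` (`tendsto_mul_anchoredProfile_of_finite`): `P_p`-a.s., `n φ̂_n → φ(p)` if `|C(0)| = ∞` and
`n φ̂_n → 0` if `|C(0)| < ∞`. [cite: CerfDembin2020, §1 (display after Theorem 1.1)] -/
theorem CerfDembin2020_thm11.ae_tendsto_mul_anchoredProfile (h : CerfDembin2020_thm11)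
    (hd : 2 ≤ d) (p : unitInterval) (hp : criticalProb (zdGraph d) (0 : Site d) < (p : ℝ)) :
    ∃ φ : ℝ, 0 < φ ∧ ∀ᵐ ω ∂(bondPercolation (zdGraph d) p),
      Tendsto (fun n : ℕ => (n : ℝ) * anchoredProfile d n ω) atTop
        (𝓝 (if (openCluster ω 0).Infinite then φ else 0)) := by
  obtain ⟨φ, hφ, hae⟩ := h d hd p hp
  refine ⟨φ, hφ, hae.mono fun ω hω => ?_⟩
  by_cases hinf : (openCluster ω 0).Infinite
  · rw [if_pos hinf]
    exact hω hinf
  · rw [if_neg hinf]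
    exact tendsto_mul_anchoredProfile_of_finite (by omega) (Set.not_infinite.1 hinf)

end ZeroIff

/-! ## §2 Measurability of `φ̂_n` -/

section Measurability

/-- The event "`H` is a valid subgraph of `C(0)`" is measurable (a finite intersection of the
cylinder events `{0 ↔ x in H}`, `PlanarDuality.determinedBy_openConnIn`). [folklore] -/
theorem measurableSet_isValidSubgraph (H : Finset (Site d)) :
    MeasurableSet {ω : BondConfig (Site d) | IsValidSubgraph d ω H} := by
  by_cases h0 : (0 : Site d) ∈ H
  · have : {ω : BondConfig (Site d) | IsValidSubgraph d ω H} =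
        ⋂ x ∈ H, (openConnIn (↑H : Set (Site d)) 0 x : Set (BondConfig (Site d))) := by
      ext ω
      simp only [IsValidSubgraph, Set.mem_setOf_eq, Set.mem_iInter]
      exact ⟨fun h => h.2, fun h => ⟨h0, h⟩⟩
    rw [this]
    exact Finset.measurableSet_biInter H fun x _ =>
      (PlanarDuality.determinedBy_openConnIn H 0 x).measurableSet_of_finset
  · have : {ω : BondConfig (Site d) | IsValidSubgraph d ω H} = ∅ :=
      Set.eq_empty_iff_forall_notMem.2 fun ω h => h0 h.1
    rw [this]
    exact MeasurableSet.empty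

/-- `ω ↦ |∂_{C(0)} H|(ω)` is measurable (it reads the finitely many edges of `∂H`). [folklore] -/
theorem measurable_openEdgeBoundaryCard (H : Finset (Site d)) :
    Measurable fun ω : BondConfig (Site d) => openEdgeBoundaryCard d ω H := by
  unfold openEdgeBoundaryCard
  refine measurable_ncard.comp ?_
  rw [measurable_set_iff]
  intro e
  simp only [Set.mem_inter_iff, Finset.mem_coe]
  exact measurable_const.and (measurable_set_mem e)

open Classical in
/-- **`φ̂_n` as a countable infimum** (`n^d ≥ 1`): `φ̂_n(ω) = inf_H F_H(ω)` over ALL finite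
`H ⊆ ℤ^d`, where `F_H(ω)` is the ratio of `H` if `H` is valid with `|H| ≤ n^d` and the a priori
bound `2d` otherwise (the minimum is attained and all ratios are `≤ 2d`). [folklore] -/
theorem anchoredProfile_eq_iInf {n : ℕ} (hn : 1 ≤ n ^ d) (ω : BondConfig (Site d)) :
    anchoredProfile d n ω = ⨅ H : Finset (Site d),
      (if IsValidSubgraph d ω H ∧ H.card ≤ n ^ d then (openEdgeBoundaryCard d ω H : ℝ) / H.card
        else 2 * (d : ℝ)) := by
  refine le_antisymm (le_ciInf fun H => ?_) ?_
  · split_ifs with h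
    · exact anchoredProfile_le_div h.1 h.2
    · exact anchoredProfile_le_two_mul' hn ω
  · obtain ⟨H₀, hH₀, -, hle, hr⟩ := exists_isValidSubgraph_anchoredProfile_eq' hn ω
    refine ciInf_le_of_le ⟨0, ?_⟩ H₀ ?_
    · rintro r ⟨H, rfl⟩
      dsimp only
      split_ifs
      · positivity
      · positivity
    · rw [if_pos ⟨hH₀, hle⟩, ← hr]

/-- **`φ̂_n` is a random variable**: `ω ↦ φ̂_n(ω)` is measurable for the product σ-algebra on bond
configurations (for `n^d ≥ 1` a countable infimum of measurable functions, `anchoredProfile_eq_iInf`;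
for `n^d = 0` the constant `0`). [folklore] -/
theorem measurable_anchoredProfile (d n : ℕ) : Measurable (anchoredProfile d n) := by
  classical
  by_cases hn : 1 ≤ n ^ d
  · have heq : anchoredProfile d n = fun ω => ⨅ H : Finset (Site d),
        (if IsValidSubgraph d ω H ∧ H.card ≤ n ^ d then (openEdgeBoundaryCard d ω H : ℝ) / H.card
          else 2 * (d : ℝ)) :=
      funext fun ω => anchoredProfile_eq_iInf hn ω
    rw [heq]
    refine Measurable.iInf fun H => Measurable.ite ?_ ?_ measurable_const
    · simp only [Set.setOf_and]
      refine (measurableSet_isValidSubgraph H).inter ?_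
      by_cases h : H.card ≤ n ^ d
      · simp only [h, Set.setOf_true, MeasurableSet.univ]
      · simp only [h, Set.setOf_false, MeasurableSet.empty]
    · exact (measurable_from_nat.comp (measurable_openEdgeBoundaryCard H)).div_const _
  · have heq : anchoredProfile d n = fun _ => 0 :=
      funext fun ω => anchoredProfile_of_pow_eq_zero (by omega) ω
    rw [heq]
    exact measurable_const

/-- Hence the rescaled profile `ω ↦ n φ̂_n(ω)` is measurable, and so are the events
`{n φ̂_n ≤ c}`, `{n φ̂_n ≥ c}` of the large-deviation statements of [Dembin2020, Thms. 3, 4].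
[folklore] -/
theorem measurable_mul_anchoredProfile (d n : ℕ) :
    Measurable fun ω : BondConfig (Site d) => (n : ℝ) * anchoredProfile d n ω :=
  (measurable_anchoredProfile d n).const_mul _

end Measurability

/-! ## §3 `n φ̂_n ≤ c` in terms of valid subgraphs: the form in which Theorem 1.2 is vendored -/

section Dictionary

/-- For `n^d ≥ 1`: `n φ̂_n ≤ c` iff some valid `H` with `|H| ≤ n^d` has `n |∂_{C(0)} H| ≤ c |H|`
(the minimum is attained). This is the dictionary between the `ε`–`N` form of
`CerfDembin2020_thm12` and `anchoredProfile`. [cite: CerfDembin2020, §1 (definition of φ̂_n) and Thm 1.2] -/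
theorem mul_anchoredProfile_le_iff {n : ℕ} (hn : 1 ≤ n ^ d) (ω : BondConfig (Site d)) (c : ℝ) :
    (n : ℝ) * anchoredProfile d n ω ≤ c ↔
      ∃ H : Finset (Site d), IsValidSubgraph d ω H ∧ H.card ≤ n ^ d ∧
        (n : ℝ) * (openEdgeBoundaryCard d ω H : ℝ) ≤ c * H.card := by
  constructor
  · intro h
    obtain ⟨H, hH, -, hle, hr⟩ := exists_isValidSubgraph_anchoredProfile_eq' hn ω
    refine ⟨H, hH, hle, ?_⟩
    have hpos : (0 : ℝ) < H.card := by exact_mod_cast hH.card_pos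
    rw [hr, ← mul_div_assoc, div_le_iff₀ hpos] at h
    exact h
  · rintro ⟨H, hH, hle, h⟩
    have hpos : (0 : ℝ) < H.card := by exact_mod_cast hH.card_pos
    calc (n : ℝ) * anchoredProfile d n ω
        ≤ n * ((openEdgeBoundaryCard d ω H : ℝ) / H.card) :=
          mul_le_mul_of_nonneg_left (anchoredProfile_le_div hH hle) (Nat.cast_nonneg n)
      _ = n * (openEdgeBoundaryCard d ω H : ℝ) / H.card := (mul_div_assoc _ _ _).symm
      _ ≤ c := by rwa [div_le_iff₀ hpos]

/-- **`CerfDembin2020_thm12` says: a.s., `n φ̂_n(p_c) ≤ c` infinitely often, for every `c > 0`.**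
The vendored `ε`–`N` form (with its explicit valid subgraphs) is equivalent to
"`∀ c > 0`, frequently `n φ̂_n ≤ c`" (`mul_anchoredProfile_le_iff`; a witness `n` of the `ε`–`N`
form carries a valid `H` with `1 ≤ |H| ≤ n^d`, and conversely one may ask `n ≥ max N 1`).
[cite: CerfDembin2020, Thm 1.2] -/
theorem CerfDembin2020_thm12_iff_frequently :
    CerfDembin2020_thm12 ↔ ∀ d : ℕ, 2 ≤ d →
      ∀ᵐ ω ∂(bondPercolation (zdGraph d) (criticalProbI d)),
        ∀ c : ℝ, 0 < c → ∃ᶠ n : ℕ in atTop, (n : ℝ) * anchoredProfile d n ω ≤ c := by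
  refine forall₂_congr fun d _ => Filter.eventually_congr (Filter.Eventually.of_forall fun ω => ?_)
  refine forall₂_congr fun c _ => ?_
  rw [Filter.frequently_atTop]
  constructor
  · intro h N
    obtain ⟨n, hNn, H, hH, hle, hmul⟩ := h N
    exact ⟨n, hNn, (mul_anchoredProfile_le_iff (hH.card_pos.trans_le hle) ω c).2 ⟨H, hH, hle, hmul⟩⟩
  · intro h N
    obtain ⟨n, hNn, hmul⟩ := h (max N 1)
    obtain ⟨H, hH, hle, hH'⟩ :=
      (mul_anchoredProfile_le_iff (Nat.one_le_pow d n (le_of_max_le_right hNn)) ω c).1 hmul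
    exact ⟨n, le_of_max_le_left hNn, H, hH, hle, hH'⟩

/-- A non-negative real sequence which is `≤ c` infinitely often for every `c > 0` has
`liminf = 0` (the converse fails for Mathlib's `Filter.liminf` on `ℝ` when the sequence is
unbounded above, `sSup` of an unbounded set being the junk `0` — the reason the fact is vendored
in `ε`–`N` form). [folklore] -/
theorem liminf_eq_zero_of_frequently_le {f : ℕ → ℝ} (hf : ∀ n, 0 ≤ f n)
    (h : ∀ c : ℝ, 0 < c → ∃ᶠ n in atTop, f n ≤ c) : Filter.liminf f atTop = 0 := by
  rw [Filter.liminf_eq]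
  have hS : {a : ℝ | ∀ᶠ n in atTop, a ≤ f n} = Set.Iic 0 := by
    ext a
    simp only [Set.mem_setOf_eq, Set.mem_Iic]
    constructor
    · intro ha
      by_contra hlt
      push Not at hlt
      obtain ⟨n, hn1, hn2⟩ := (ha.and_frequently (h (a / 2) (by positivity))).exists
      linarith
    · intro ha
      exact Filter.Eventually.of_forall fun n => ha.trans (hf n)
  rw [hS, csSup_Iic]

/-- **The printed form of Theorem 1.2 from the vendored one**: `CerfDembin2020_thm12` implies
`P_{p_c}`-a.s. `liminf_{n → ∞} n φ̂_n(p_c) = 0` (with Mathlib's `Filter.liminf`).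
[cite: CerfDembin2020, Thm 1.2] -/
theorem CerfDembin2020_thm12.ae_liminf_eq_zero (h : CerfDembin2020_thm12) (hd : 2 ≤ d) :
    ∀ᵐ ω ∂(bondPercolation (zdGraph d) (criticalProbI d)),
      Filter.liminf (fun n : ℕ => (n : ℝ) * anchoredProfile d n ω) atTop = 0 := by
  filter_upwards [CerfDembin2020_thm12_iff_frequently.1 h d hd] with ω hω
  exact liminf_eq_zero_of_frequently_le
    (fun n => mul_nonneg (Nat.cast_nonneg n) (anchoredProfile_nonneg n ω)) hω

end Dictionary

end Literature.Probability.Percolation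

end
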